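import Summits.CriticalPhenomena.PercolationContinuityZ3.Theorems.PercNearOneGluingNoHeavyLowerTailSahiTwoLevelRecursiveCertified
import Summits.CriticalPhenomena.PercolationContinuityZ3.Theorems.PercNearOneGluingNoHeavyLowerTailSahiTwoLevelVariationalMoves
import Mathlib.Tactic.Linarith
import HarnessLib

/-!
# Kahn's inequality on the SATURATION-CERTIFIED class: the monotone moves of the two-level top form inside the good-coordinate recursion

Support file of the one-cut programme (crux `NoHeavyLowerTail`, stmt-CriticalPhenomena-4575; master-family line P2 = Sahi's algebraic route,
seat `prim-masterthm-p2` gen 22; memo `run/shared/lean/prim/prim-masterthm/FROM-prim-masterthm-p2-g22-SATURATION.md`).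
Four definitions (`NestedUp`, `MoveStep`, `Reaches`, `SatFace`), no sorry; axioms standard.

THE POINT.  Gen 21 proved Kahn's inequality `E_3(μ_q; U) ≥ 0` on every class of increasing triples certified RECURSIVELY by purely
set-theoretic certificates (absorbing head [P3] | two members on coordinate sets sharing ≤ 1 coin [bnk-2] | inessential coordinate |
a coordinate `e` whose pair of sections `(G, H) = (U^{e←1}, U^{e←0})` lies in a face of the two-level TOP law `T⁺(G,H) ≥ 0`)
(`…RecursiveAbsorbing`, `…RecursiveCertified`).  Gen 20 proved that `T⁺` is affine in each of the six events with signed point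
coefficients, whence four MONOTONE MOVES (`…VariationalMoves`): (T+) add to a top `G_0` a set avoiding `G_1 ∩ G_2`; (T−) remove from `G_0`
a part of `G_1 ∩ G_2` missing `H_0`; (B+) add to a bottom `H_0` a part of `G_0` avoiding `H_1 ∩ H_2`; (B−) remove from `H_0` a part of
`H_1 ∩ H_2` — none of them increases `T⁺`, for EVERY product measure.  This file puts the two together:

* `MoveStep` — one valid move at slot `0`, or the cyclic rotation of the slots (so that moves at every slot are chains of steps); its
  reflexive-transitive closure is the reachability relation of nested pairs of increasing triples;
* `nestedUp_of_moveStep`, `topForm_le_of_moveStep`, `topForm_le_of_reaches` — every reachable pair is a nested pair of increasing triples with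
  NO LARGER `T⁺` (all `q`);
* `SatFace P S G H` — the BIAS-FREE faces with slot `0` designated, each with the Kahn side conditions it needs expressed through the class
  predicate `P`: top-absorbing `G_1 ∩ G_2 ⊆ G_0` (none) | independent tops (none) | W-face `H_0 ∩ G_1 ∩ G_2 ⊆ H_1 ∩ H_2` (`P G`, `P (H_0,G_1,G_2)`)
  | costless-inside `G_0G_1G_2 ⊆ H_0 ∧ D_1 ∩ D_2 ⊆ G_0` (`P (G_0,H_1,G_2)`, `P (G_0,G_1,H_2)`) | idle slot with a shell inside the idle top
  `H_0 = G_0 ∧ (D_1 ⊆ G_0 ∨ D_2 ⊆ G_0)` (`P G`, `P (G_0,H_1,H_2)`; the bracket of bnk-2's idle face is then `≥ δ_1δ_2(1 − μ G_0) ≥ 0` for every `q`,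
  `bracket_nonneg_of_shell_subset`);
* `sahiE3_nonneg_of_topForm_secAt_nonneg` — a coordinate where the top law holds for the sections is a good coordinate (P1's weak local step);
* **`sahiE3_nonneg_of_recursivelySaturated`** — KAHN'S INEQUALITY ON EVERY SATURATION-CERTIFIED CLASS: if `P S U` always certifies an
  absorbing head, or ≤ 1 shared coin, or an inessential coordinate, or a coordinate `e ∈ S` together with a nested pair `(G', H')` REACHABLE
  from the sections by moves, determined by `S ∖ e`, lying in a `SatFace` (with `P (S ∖ e)` for the two section triples and for the face's
  mixed triples), then `E_3(μ_q; U) ≥ 0` for every increasing `U` determined by `S` with `P S U` — for EVERY `q`, since every certificate is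
  set-theoretic.

CENSUS (this seat, `code/g22/ksat.py`, pure python; memo §1–§2): the least such class `K_sat` contains every one of 10⁶ random triples of
up-sets on 5 coins, every one of 3·10⁵ on 6 coins and 99 997 of 10⁵ on 7 coins (gen 21's sampler; gen 21's move-free class `K_comb` missed
≈ 4·10⁻⁵ / 2·10⁻⁴ there), and 23 of the 26 listed 6-coin / 18 of the 20 listed 7-coin `K_comb`-exceptions of gen 21; a sampler weighted towards
2–3-coin AND-OR terms finds the residual at rate ≈ 10⁻⁴ on 6 coins: "cyclic" triples such as the HEXAGON `(x0x2 ∨ x1x3, x1x4 ∨ x0x5, x2x4 ∨ x3x5)`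
(the three pairs of opposite edges of a 6-cycle; a class-T triangle with 2-coin blocks), whose move-closed section pairs lie outside every
bias-free face at all coordinates.  HONEST LABEL: Kahn's Conjecture 5 / `SahiTwoLevelPlus` remain OPEN; this is a (larger) class on which
the inequality is a theorem for all product measures, and its complement is where coordinate induction needs quantitative input. [this work]
-/

noncomputable section

open scoped Classical

namespace Summit.CriticalPhenomena.PercolationContinuityZ3.Theorems

namespace SahiTwoLevelVariational

open Finset Function MeasureTheory
open Literature.Combinatorics.Sahi2008
open Literature.Probability.LatticeModels (prodBernoulli prodBernoulli_harris sahiE3 sahiE3_def)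
open Literature.Probability.Percolation (DeterminedBy determinedBy_iff)
open Literature.Probability.Percolation.DecisionTree (ind ind_of_mem ind_of_not_mem ind_nonneg)
open SahiCoordinateBernstein (coordPiece₂)

variable {κ : Type} [Fintype κ]

/-! ### 1. Nested pairs of increasing triples and the move steps -/

/-- A nested pair of increasing triples: all six events increasing and `H_i ⊆ G_i`. [this work] -/
def NestedUp (G H : Fin 3 → Set (Set κ)) : Prop :=
  (∀ i, IsUpperSet (G i)) ∧ (∀ i, IsUpperSet (H i)) ∧ ∀ i, H i ⊆ G i

omit [Fintype κ] in
/-- A triple equals the literal triple of its components. [folklore] -/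
theorem eq_vec3 (X : Fin 3 → Set (Set κ)) : X = ![X 0, X 1, X 2] := by
  funext i; fin_cases i <;> rfl

omit [Fintype κ] in
/-- `NestedUp` is stable under the cyclic rotation of the slots. [this work] -/
theorem nestedUp_rot {G H : Fin 3 → Set (Set κ)} (h : NestedUp G H) : NestedUp (rot G) (rot H) := by
  obtain ⟨hG, hH, hHG⟩ := h
  refine ⟨fun i => ?_, fun i => ?_, fun i => ?_⟩
  · fin_cases i
    · exact hG 1
    · exact hG 2
    · exact hG 0
  · fin_cases i
    · exact hH 1
    · exact hH 2
    · exact hH 0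
  · fin_cases i
    · exact hHG 1
    · exact hHG 2
    · exact hHG 0

/-- **One MOVE STEP** between pairs of triples of events: a valid move at slot `0` — (T+) `G_0 ↦ G_0 ∪ A` with `A` avoiding `G_1 ∩ G_2`;
(T−) `G_0 ↦ G_0 ∖ K` with `K ⊆ G_0G_1G_2` missing `H_0`; (B+) `H_0 ↦ H_0 ∪ A` with `A ⊆ G_0` avoiding `H_1 ∩ H_2`; (B−) `H_0 ↦ H_0 ∖ K` with
`K ⊆ H_0H_1H_2` — each keeping the moved event increasing — or the cyclic rotation of the slots.  Purely set-theoretic. [this work] -/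
inductive MoveStep : (Fin 3 → Set (Set κ)) → (Fin 3 → Set (Set κ)) → (Fin 3 → Set (Set κ)) → (Fin 3 → Set (Set κ)) → Prop
  | topAdd (G H : Fin 3 → Set (Set κ)) (A : Set (Set κ)) :
      Disjoint (G 0) A → A ∩ G 1 ∩ G 2 = ∅ → IsUpperSet (G 0 ∪ A) → MoveStep G H ![G 0 ∪ A, G 1, G 2] H
  | topSub (G H : Fin 3 → Set (Set κ)) (K : Set (Set κ)) :
      K ⊆ G 0 ∩ G 1 ∩ G 2 → Disjoint K (H 0) → IsUpperSet (G 0 \ K) → MoveStep G H ![G 0 \ K, G 1, G 2] H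
  | botAdd (G H : Fin 3 → Set (Set κ)) (A : Set (Set κ)) :
      Disjoint (H 0) A → A ⊆ G 0 → A ∩ H 1 ∩ H 2 = ∅ → IsUpperSet (H 0 ∪ A) → MoveStep G H G ![H 0 ∪ A, H 1, H 2]
  | botSub (G H : Fin 3 → Set (Set κ)) (K : Set (Set κ)) :
      K ⊆ H 0 ∩ H 1 ∩ H 2 → IsUpperSet (H 0 \ K) → MoveStep G H G ![H 0 \ K, H 1, H 2]
  | rotate (G H : Fin 3 → Set (Set κ)) : MoveStep G H (rot G) (rot H)

/-- **Reachability by moves**: the reflexive-transitive closure of `MoveStep`. [this work] -/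
inductive Reaches : (Fin 3 → Set (Set κ)) → (Fin 3 → Set (Set κ)) → (Fin 3 → Set (Set κ)) → (Fin 3 → Set (Set κ)) → Prop
  | refl (G H : Fin 3 → Set (Set κ)) : Reaches G H G H
  | tail {G H G' H' G'' H'' : Fin 3 → Set (Set κ)} : Reaches G H G' H' → MoveStep G' H' G'' H'' → Reaches G H G'' H''

omit [Fintype κ] in
/-- Every move step keeps the pair a nested pair of increasing triples. [this work] -/
theorem nestedUp_of_moveStep {G H G' H' : Fin 3 → Set (Set κ)} (hs : MoveStep G H G' H') (h : NestedUp G H) : NestedUp G' H' := by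
  obtain ⟨hG, hH, hHG⟩ := h
  cases hs with
  | topAdd A hdisj hA hup =>
    refine ⟨fun i => ?_, hH, fun i => ?_⟩
    · fin_cases i
      · exact hup
      · exact hG 1
      · exact hG 2
    · fin_cases i
      · exact (hHG 0).trans Set.subset_union_left
      · exact hHG 1
      · exact hHG 2
  | topSub K hK hKH hup =>
    refine ⟨fun i => ?_, hH, fun i => ?_⟩
    · fin_cases i
      · exact hup
      · exact hG 1
      · exact hG 2
    · fin_cases i
      · intro ω hω
        exact ⟨hHG 0 hω, fun hK' => Set.disjoint_left.1 hKH hK' hω⟩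
      · exact hHG 1
      · exact hHG 2
  | botAdd A hdisj hAG hA hup =>
    refine ⟨hG, fun i => ?_, fun i => ?_⟩
    · fin_cases i
      · exact hup
      · exact hH 1
      · exact hH 2
    · fin_cases i
      · exact Set.union_subset (hHG 0) hAG
      · exact hHG 1
      · exact hHG 2
  | botSub K hK hup =>
    refine ⟨hG, fun i => ?_, fun i => ?_⟩
    · fin_cases i
      · exact hup
      · exact hH 1
      · exact hH 2
    · fin_cases i
      · exact Set.sdiff_subset.trans (hHG 0)
      · exact hHG 1
      · exact hHG 2
  | rotate => exact nestedUp_rot ⟨hG, hH, hHG⟩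

/-- **Every move step weakly decreases `T⁺`**, for every product measure. [this work] -/
theorem topForm_le_of_moveStep (q : κ → unitInterval) {G H G' H' : Fin 3 → Set (Set κ)} (hs : MoveStep G H G' H')
    (h : NestedUp G H) : topForm q G' H' ≤ topForm q G H := by
  obtain ⟨hG, hH, hHG⟩ := h
  cases hs with
  | topAdd A hdisj hA hup =>
    have := topForm_top_union_le q H (G 0) A (G 1) (G 2) (hH 1) (hH 2) (hHG 1) (hHG 2) hdisj hA
    rwa [← eq_vec3 G] at this
  | topSub K hK hKH hup =>
    have := topForm_top_sdiff_le q H (G 0) K (G 1) (G 2) (hHG 1) (hHG 2) hK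
    rwa [← eq_vec3 G] at this
  | botAdd A hdisj hAG hA hup =>
    have := topForm_bottom_union_le q G (H 0) A (H 1) (H 2) (hG 1) (hG 2) hdisj hA
    rwa [← eq_vec3 H] at this
  | botSub K hK hup =>
    have := topForm_bottom_sdiff_le q G (H 0) K (H 1) (H 2) hK
    rwa [← eq_vec3 H] at this
  | rotate => exact (topForm_rot q G H).le

omit [Fintype κ] in
/-- Reachable pairs are nested pairs of increasing triples. [this work] -/
theorem nestedUp_of_reaches {G H G' H' : Fin 3 → Set (Set κ)} (hr : Reaches G H G' H') (h : NestedUp G H) : NestedUp G' H' := by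
  induction hr with
  | refl => exact h
  | tail _ hstep ih => exact nestedUp_of_moveStep hstep ih

/-- **`T⁺` does not increase along move chains**: `Reaches (G,H) (G',H') ⟹ T⁺(G',H') ≤ T⁺(G,H)` for every `q`. [this work] -/
theorem topForm_le_of_reaches (q : κ → unitInterval) {G H G' H' : Fin 3 → Set (Set κ)} (hr : Reaches G H G' H')
    (h : NestedUp G H) : topForm q G' H' ≤ topForm q G H := by
  induction hr with
  | refl => exact le_rfl
  | tail hr' hstep ih => exact (topForm_le_of_moveStep q hstep (nestedUp_of_reaches hr' h)).trans ih

/-! ### 2. The bias-free faces (slot `0` designated) -/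

/-- **The idle bracket is nonnegative when a shell lies inside the idle top**: if `G_1 ∖ H_1 ⊆ G_0` (or `G_2 ∖ H_2 ⊆ G_0`) then
`μ(G_0)·δ_1δ_2 ≤ δ_2·μ(G_0 ∩ D_1) + δ_1·μ(G_0 ∩ D_2)` (indeed the right side is `≥ δ_1δ_2`). [this work] -/
theorem bracket_nonneg_of_shell_subset (q : κ → unitInterval) (G H : Fin 3 → Set (Set κ)) (hHG : ∀ i, H i ⊆ G i)
    (hD : G 1 \ H 1 ⊆ G 0 ∨ G 2 \ H 2 ⊆ G 0) :
    (prodBernoulli q).real (G 0) * ((prodBernoulli q).real (G 1) - (prodBernoulli q).real (H 1))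
        * ((prodBernoulli q).real (G 2) - (prodBernoulli q).real (H 2)) ≤
      ((prodBernoulli q).real (G 2) - (prodBernoulli q).real (H 2))
          * ((prodBernoulli q).real (G 0 ∩ G 1) - (prodBernoulli q).real (G 0 ∩ H 1))
      + ((prodBernoulli q).real (G 1) - (prodBernoulli q).real (H 1))
          * ((prodBernoulli q).real (G 0 ∩ G 2) - (prodBernoulli q).real (G 0 ∩ H 2)) := by
  have hg0 : (prodBernoulli q).real (G 0) ≤ 1 := measureReal_le_one
  have hg0' : 0 ≤ (prodBernoulli q).real (G 0) := measureReal_nonneg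
  have hd1 : 0 ≤ (prodBernoulli q).real (G 1) - (prodBernoulli q).real (H 1) := sub_nonneg.2 (measureReal_mono (hHG 1))
  have hd2 : 0 ≤ (prodBernoulli q).real (G 2) - (prodBernoulli q).real (H 2) := sub_nonneg.2 (measureReal_mono (hHG 2))
  have hm1 : 0 ≤ (prodBernoulli q).real (G 0 ∩ G 1) - (prodBernoulli q).real (G 0 ∩ H 1) :=
    sub_nonneg.2 (measureReal_mono (Set.inter_subset_inter_right _ (hHG 1)))
  have hm2 : 0 ≤ (prodBernoulli q).real (G 0 ∩ G 2) - (prodBernoulli q).real (G 0 ∩ H 2) :=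
    sub_nonneg.2 (measureReal_mono (Set.inter_subset_inter_right _ (hHG 2)))
  -- the shell inside `G 0` has `μ(G_0 ∩ G_j) − μ(G_0 ∩ H_j) = μ(G_j) − μ(H_j)`
  have key : ∀ j : Fin 3, G j \ H j ⊆ G 0 → H j ⊆ G j →
      (prodBernoulli q).real (G 0 ∩ G j) - (prodBernoulli q).real (G 0 ∩ H j)
        = (prodBernoulli q).real (G j) - (prodBernoulli q).real (H j) := by
    intro j hDj hHj
    have e1 : G 0 ∩ G j = (G 0 ∩ H j) ∪ (G j \ H j) := by
      ext ω; simp only [Set.mem_inter_iff, Set.mem_union, Set.mem_sdiff]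
      constructor
      · rintro ⟨h0, hj⟩
        by_cases hω : ω ∈ H j
        · exact Or.inl ⟨h0, hω⟩
        · exact Or.inr ⟨hj, hω⟩
      · rintro (⟨h0, hω⟩ | ⟨hj, hω⟩)
        · exact ⟨h0, hHj hω⟩
        · exact ⟨hDj ⟨hj, hω⟩, hj⟩
    have e2 : G j = H j ∪ (G j \ H j) := (Set.union_sdiff_cancel hHj).symm
    have d1 : Disjoint (G 0 ∩ H j) (G j \ H j) :=
      Set.disjoint_left.2 fun ω hω hω' => hω'.2 hω.2
    have d2 : Disjoint (H j) (G j \ H j) := Set.disjoint_sdiff_right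
    rw [e1, real_union_of_disjoint q d1]
    conv_rhs => rw [e2, real_union_of_disjoint q d2]
    ring
  rcases hD with h1 | h2
  · rw [key 1 h1 (hHG 1)]
    nlinarith [mul_nonneg hd1 hm2, mul_nonneg (mul_nonneg hd1 hd2) (sub_nonneg.2 hg0)]
  · rw [key 2 h2 (hHG 2)]
    nlinarith [mul_nonneg hd2 hm1, mul_nonneg (mul_nonneg hd1 hd2) (sub_nonneg.2 hg0)]

/-- **The bias-free faces with slot `0` designated**, relative to a class predicate `P` at coordinate set `S` supplying the Kahn side
conditions: (TA) `G_1 ∩ G_2 ⊆ G_0`; (IT) `G_0, G_1` determined by complementary coordinate sets; (W) `H_0 ∩ G_1 ∩ G_2 ⊆ H_1 ∩ H_2` with `P S G`,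
`P S (H_0,G_1,G_2)`; (CI) `G_0G_1G_2 ⊆ H_0`, `D_1 ∩ D_2 ⊆ G_0` with `P S (G_0,H_1,G_2)`, `P S (G_0,G_1,H_2)`; (IS) `H_0 = G_0`, a shell `D_1` or `D_2`
inside `G_0`, with `P S G`, `P S (G_0,H_1,H_2)`.  Purely set-theoretic in `(G,H)`. [this work] -/
def SatFace (P : Finset κ → (Fin 3 → Set (Set κ)) → Prop) (S : Finset κ) (G H : Fin 3 → Set (Set κ)) : Prop :=
  (G 1 ∩ G 2 ⊆ G 0)
  ∨ (∃ T : Finset κ, DeterminedBy (G 0) (↑T : Set κ)ᶜ ∧ DeterminedBy (G 1) (↑T : Set κ))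
  ∨ (H 0 ∩ G 1 ∩ G 2 ⊆ H 1 ∩ H 2 ∧ P S G ∧ P S ![H 0, G 1, G 2])
  ∨ (G 0 ∩ G 1 ∩ G 2 ⊆ H 0 ∧ (G 1 \ H 1) ∩ (G 2 \ H 2) ⊆ G 0 ∧ P S ![G 0, H 1, G 2] ∧ P S ![G 0, G 1, H 2])
  ∨ (H 0 = G 0 ∧ (G 1 \ H 1 ⊆ G 0 ∨ G 2 \ H 2 ⊆ G 0) ∧ P S G ∧ P S ![G 0, H 1, H 2])

/-- **`T⁺ ≥ 0` on a `SatFace`**, given Kahn's inequality for the `P`-certified triples built from the six events. [this work] -/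
theorem topForm_nonneg_of_satFace (q : κ → unitInterval) (P : Finset κ → (Fin 3 → Set (Set κ)) → Prop) (S : Finset κ)
    (G H : Fin 3 → Set (Set κ)) (hN : NestedUp G H)
    (hKahn : ∀ X : Fin 3 → Set (Set κ), (∀ i, X i = G i ∨ X i = H i) → P S X → 0 ≤ sahiE3 (prodBernoulli q) (X 0) (X 1) (X 2))
    (hF : SatFace P S G H) : 0 ≤ topForm q G H := by
  obtain ⟨hG, hH, hHG⟩ := hN
  have kG : P S G → 0 ≤ sahiE3 (prodBernoulli q) (G 0) (G 1) (G 2) := fun hP => hKahn G (fun i => Or.inl rfl) hP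
  have kHGG : P S ![H 0, G 1, G 2] → 0 ≤ sahiE3 (prodBernoulli q) (H 0) (G 1) (G 2) := fun hP => by
    have := hKahn ![H 0, G 1, G 2] (fun i => by fin_cases i <;> simp) hP
    simpa using this
  have kGHG : P S ![G 0, H 1, G 2] → 0 ≤ sahiE3 (prodBernoulli q) (G 0) (H 1) (G 2) := fun hP => by
    have := hKahn ![G 0, H 1, G 2] (fun i => by fin_cases i <;> simp) hP
    simpa using this
  have kGGH : P S ![G 0, G 1, H 2] → 0 ≤ sahiE3 (prodBernoulli q) (G 0) (G 1) (H 2) := fun hP => by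
    have := hKahn ![G 0, G 1, H 2] (fun i => by fin_cases i <;> simp) hP
    simpa using this
  have kGHH : P S ![G 0, H 1, H 2] → 0 ≤ sahiE3 (prodBernoulli q) (G 0) (H 1) (H 2) := fun hP => by
    have := hKahn ![G 0, H 1, H 2] (fun i => by fin_cases i <;> simp) hP
    simpa using this
  rw [topForm_def]
  rcases hF with hTA | ⟨T, hT0, hT1⟩ | ⟨hW, hPG, hPH⟩ | ⟨hc0, hin, hPa, hPb⟩ | ⟨h0, hD, hPG, hPm⟩
  · exact twoLevelPlus_nonneg_of_topAbsorbing q G H hG hH hHG (Or.inl hTA)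
  · exact SahiTwoLevelIndep.twoLevelPlus_nonneg_of_determinedBy q T G H hG hH hHG hT0 hT1
  · exact SahiTwoLevelWForm.twoLevelTop_nonneg_of_wFace₀ q G H hG (hHG 1) (hHG 2) hW (kG hPG) (kHGG hPH)
  · exact SahiTwoLevelIdle.twoLevelTop_nonneg_of_costless₀_inside q G H hG (hHG 0) (hHG 1) (hHG 2) hc0 hin (kGHG hPa) (kGGH hPb)
  · rw [SahiTwoLevelIdle.twoLevelTop_eq_of_idle₀ q G H h0]
    have hbr := bracket_nonneg_of_shell_subset q G H hHG hD
    linarith [kG hPG, kGHH hPm]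

/-! ### 3. A coordinate where the top law holds for the sections is a good coordinate -/

/-- **A coordinate at which the two-level top law holds for the sections is a good coordinate**: `T⁺(U^{e←1}, U^{e←0}) ≥ 0` and Kahn's
inequality for the two section triples give `E_3(μ_q; U) ≥ 0` (P1's weak local step). [this work] -/
theorem sahiE3_nonneg_of_topForm_secAt_nonneg (q : κ → unitInterval) (e : κ) {A B C : Set (Set κ)}
    (hA : IsUpperSet A) (hB : IsUpperSet B) (hC : IsUpperSet C)
    (hT : 0 ≤ topForm q ![secAt e true A, secAt e true B, secAt e true C] ![secAt e false A, secAt e false B, secAt e false C])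
    (h0 : 0 ≤ sahiE3 (prodBernoulli q) (secAt e false A) (secAt e false B) (secAt e false C))
    (h1 : 0 ≤ sahiE3 (prodBernoulli q) (secAt e true A) (secAt e true B) (secAt e true C)) :
    0 ≤ sahiE3 (prodBernoulli q) A B C := by
  rw [← sahiE_three_ind] at h0 h1 ⊢
  have hb := SahiTwoLevel.coordPiece₂_add_eq_twoLevelPlus q e A B C
  simp only [ex_bernoulliWeight_ind] at hb
  have hW : 0 ≤ coordPiece₂ q e ![A, B, C]
      + sahiE (bernoulliWeight q) 3 ![ind (secAt e false A), ind (secAt e false B), ind (secAt e false C)]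
      + sahiE (bernoulliWeight q) 3 ![ind (secAt e true A), ind (secAt e true B), ind (secAt e true C)] := by
    rw [hb]
    simpa [topForm] using hT
  exact SahiCoSunflowerTwoLevel.sahiE_three_nonneg_of_weakTwoLevelAt q e hA hB hC hW h0 h1

/-! ### 4. The recursion with saturation certificates -/

/-- **KAHN'S INEQUALITY ON EVERY SATURATION-CERTIFIED CLASS.**  Let `P S U` be a predicate on (coordinate set, triple) that always certifies one
of: (a) an absorbing head; (d) two members determined by coordinate sets sharing at most one coin; (b) an inessential coordinate `e ∈ S` with
`P (S.erase e) U`; (s) a coordinate `e ∈ S` and a pair `(G', H')` REACHABLE BY MOVES from the pair of sections along `e`, with all six events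
determined by `S.erase e`, `P (S.erase e)` for the two section triples, and `(G', H')` in a bias-free face `SatFace P (S.erase e)`.  Then
`E_3(μ_q; U) ≥ 0` for every increasing triple `U` determined by `S` with `P S U` — for every `q`. [this work] -/
theorem sahiE3_nonneg_of_recursivelySaturated (q : κ → unitInterval) (P : Finset κ → (Fin 3 → Set (Set κ)) → Prop)
    (hP : ∀ (S : Finset κ) (U : Fin 3 → Set (Set κ)), P S U →
      (∃ i : Fin 3, ∀ ω : Set κ, (∀ k : Fin 3, k ≠ i → ω ∈ U k) → ω ∈ U i)
      ∨ (∃ T₀ T₁ : Finset κ, (T₀ ∩ T₁).card ≤ 1 ∧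
          ((DeterminedBy (U 0) (↑T₀ : Set κ) ∧ DeterminedBy (U 1) (↑T₁ : Set κ))
            ∨ (DeterminedBy (U 1) (↑T₀ : Set κ) ∧ DeterminedBy (U 2) (↑T₁ : Set κ))
            ∨ (DeterminedBy (U 0) (↑T₀ : Set κ) ∧ DeterminedBy (U 2) (↑T₁ : Set κ))))
      ∨ (∃ e ∈ S, (∀ i, DeterminedBy (U i) (↑(S.erase e) : Set κ)) ∧ P (S.erase e) U)
      ∨ (∃ e ∈ S, ∃ G' H' : Fin 3 → Set (Set κ),
          Reaches ![secAt e true (U 0), secAt e true (U 1), secAt e true (U 2)]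
              ![secAt e false (U 0), secAt e false (U 1), secAt e false (U 2)] G' H'
          ∧ (∀ i, DeterminedBy (G' i) (↑(S.erase e) : Set κ) ∧ DeterminedBy (H' i) (↑(S.erase e) : Set κ))
          ∧ P (S.erase e) ![secAt e true (U 0), secAt e true (U 1), secAt e true (U 2)]
          ∧ P (S.erase e) ![secAt e false (U 0), secAt e false (U 1), secAt e false (U 2)]
          ∧ SatFace P (S.erase e) G' H')) :
    ∀ (S : Finset κ) (U : Fin 3 → Set (Set κ)), P S U → (∀ i, IsUpperSet (U i)) → (∀ i, DeterminedBy (U i) (↑S : Set κ)) →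
      0 ≤ sahiE3 (prodBernoulli q) (U 0) (U 1) (U 2) := by
  suffices key : ∀ (m : ℕ) (S : Finset κ) (U : Fin 3 → Set (Set κ)), S.card = m → P S U → (∀ i, IsUpperSet (U i)) →
      (∀ i, DeterminedBy (U i) (↑S : Set κ)) → 0 ≤ sahiE3 (prodBernoulli q) (U 0) (U 1) (U 2) from
    fun S U hPU hU hUS => key _ S U rfl hPU hU hUS
  intro m
  induction m using Nat.strong_induction_on with
  | _ m ih =>
  intro S U hS hPU hU hUS
  rcases hP S U hPU with ⟨i, hi⟩ | ⟨T₀, T₁, hT, hdet⟩ | ⟨e, heS, hdet, hPe⟩ | ⟨e, heS, G', H', hR, hdet', hP1, hP0, hface⟩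
  · -- (a) absorbing head
    refine SahiAbsorbed.kahn_sahiE3_nonneg_of_inter_subset q (U 0) (U 1) (U 2) (hU 0) (hU 1) (hU 2) i fun ω hω => ?_
    have h := hi ω fun k hk => by
      have := hω k hk
      fin_cases k <;> simpa using this
    fin_cases i <;> simpa using h
  · -- (d) two members share at most one coin
    exact sahiE3_nonneg_of_sharedLeOne q U hU T₀ T₁ hT hdet
  · -- (b) inessential coordinate
    have hlt : (S.erase e).card < m := by rw [← hS]; exact Finset.card_erase_lt_of_mem heS
    exact ih _ hlt (S.erase e) U rfl hPe hU hdet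
  · -- (s) saturation certificate at `e`
    have hlt : (S.erase e).card < m := by rw [← hS]; exact Finset.card_erase_lt_of_mem heS
    set G : Fin 3 → Set (Set κ) := ![secAt e true (U 0), secAt e true (U 1), secAt e true (U 2)] with hGdef
    set H : Fin 3 → Set (Set κ) := ![secAt e false (U 0), secAt e false (U 1), secAt e false (U 2)] with hHdef
    have hGup : ∀ i, IsUpperSet (G i) := fun i => by
      rw [hGdef, secTriple_apply]; exact isUpperSet_secAt e true (hU i)
    have hHup : ∀ i, IsUpperSet (H i) := fun i => by
      rw [hHdef, secTriple_apply]; exact isUpperSet_secAt e false (hU i)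
    have hHG : ∀ i, H i ⊆ G i := fun i => by
      rw [hGdef, hHdef, secTriple_apply, secTriple_apply]; exact SahiTwoLevel.secAt_false_subset_true e (hU i)
    have hN : NestedUp G H := ⟨hGup, hHup, hHG⟩
    have hN' : NestedUp G' H' := nestedUp_of_reaches hR hN
    -- Kahn for the two section triples
    have h1 : 0 ≤ sahiE3 (prodBernoulli q) (secAt e true (U 0)) (secAt e true (U 1)) (secAt e true (U 2)) := by
      have := ih _ hlt (S.erase e) G rfl hP1 hGup
        (fun i => by rw [hGdef, secTriple_apply]; exact determinedBy_secAt e true (hUS i))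
      simpa [hGdef] using this
    have h0 : 0 ≤ sahiE3 (prodBernoulli q) (secAt e false (U 0)) (secAt e false (U 1)) (secAt e false (U 2)) := by
      have := ih _ hlt (S.erase e) H rfl hP0 hHup
        (fun i => by rw [hHdef, secTriple_apply]; exact determinedBy_secAt e false (hUS i))
      simpa [hHdef] using this
    -- Kahn for the `P`-certified triples built from the reached pair
    have hKahn : ∀ X : Fin 3 → Set (Set κ), (∀ i, X i = G' i ∨ X i = H' i) → P (S.erase e) X →
        0 ≤ sahiE3 (prodBernoulli q) (X 0) (X 1) (X 2) := by
      intro X hX hPX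
      have hup : ∀ i, IsUpperSet (X i) := by
        intro i; rcases hX i with h | h <;> rw [h]
        · exact hN'.1 i
        · exact hN'.2.1 i
      have hdet : ∀ i, DeterminedBy (X i) (↑(S.erase e) : Set κ) := by
        intro i; rcases hX i with h | h <;> rw [h]
        · exact (hdet' i).1
        · exact (hdet' i).2
      exact ih _ hlt (S.erase e) X rfl hPX hup hdet
    have hT' : 0 ≤ topForm q G' H' := topForm_nonneg_of_satFace q P (S.erase e) G' H' hN' hKahn hface
    have hT : 0 ≤ topForm q G H := hT'.trans (topForm_le_of_reaches q hR hN)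
    exact sahiE3_nonneg_of_topForm_secAt_nonneg q e (hU 0) (hU 1) (hU 2) hT h0 h1

end SahiTwoLevelVariational

end Summit.CriticalPhenomena.PercolationContinuityZ3.Theorems
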